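import Mathlib
import Summits.Ventures.PercRepro2.Defs
import Summits.Ventures.PercRepro2.Independence

/-!
# Finite bond percolation — order lemmas and the Harris–FKG inequality (blind cell PercRepro2)

For admissible weights (`IsProbVec p`: every `p e ∈ [0, 1]`) the weights are nonnegative, so
`prob` is monotone and takes values in `[0, 1]`.

**Harris–FKG**: for monotone observables `f g : Config E → R`,
`E_p f * E_p g ≤ E_p (f * g)`, and for increasing events (`IsUpperSet`, in the product order
on `Config E = E → Bool`, `false < true`) `P(A) P(B) ≤ P(A ∩ B)`.
The proof is by induction on the set of unpinned edges, using the pinning identity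
`expect_eq_pin` and the forcing identities `expect_update_one` / `expect_update_zero`:
with `a = p e`, `F_b = E_{p[e↦b]} f`, `G_b = E_{p[e↦b]} g`,
`E_p f · E_p g = (a F₁ + (1-a) F₀)(a G₁ + (1-a) G₀) = a F₁G₁ + (1-a) F₀G₀ - a(1-a)(F₁-F₀)(G₁-G₀)`.
-/

namespace Summit.Ventures.PercRepro2

section Order

variable {E : Type*} [Fintype E] [DecidableEq E] {R : Type*} [CommRing R] [PartialOrder R]
  [IsOrderedRing R]

/-- Admissible edge weights: every `p e` lies in `[0, 1]`. -/
structure IsProbVec (p : E → R) : Prop where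
  /-- `0 ≤ p e` -/
  nonneg : ∀ e, 0 ≤ p e
  /-- `p e ≤ 1` -/
  le_one : ∀ e, p e ≤ 1

omit [Fintype E] [IsOrderedRing R] in
/-- Pinning an edge to a value in `[0, 1]` keeps the weights admissible. -/
lemma IsProbVec.update {p : E → R} (hp : IsProbVec p) (e : E) {q : R} (h0 : 0 ≤ q)
    (h1 : q ≤ 1) : IsProbVec (Function.update p e q) := by
  refine ⟨fun e' => ?_, fun e' => ?_⟩ <;> by_cases h : e' = e
  · subst h; simp [h0]
  · simp [Function.update_of_ne h, hp.nonneg e']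
  · subst h; simp [h1]
  · simp [Function.update_of_ne h, hp.le_one e']

/-- The Bernoulli factors are nonnegative for `q ∈ [0, 1]`. -/
lemma edgeFactor_nonneg {q : R} (h0 : 0 ≤ q) (h1 : q ≤ 1) (b : Bool) : 0 ≤ edgeFactor q b := by
  cases b <;> simp [edgeFactor, h0, sub_nonneg.2 h1]

omit [DecidableEq E] in
/-- Weights are nonnegative. -/
lemma weight_nonneg {p : E → R} (hp : IsProbVec p) (ω : Config E) : 0 ≤ weight p ω :=
  Finset.prod_nonneg fun e _ => edgeFactor_nonneg (hp.nonneg e) (hp.le_one e) _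

/-- Expectation of a nonnegative observable is nonnegative. -/
lemma expect_nonneg {p : E → R} (hp : IsProbVec p) {f : Config E → R} (hf : ∀ ω, 0 ≤ f ω) :
    0 ≤ expect p f :=
  Finset.sum_nonneg fun ω _ => mul_nonneg (weight_nonneg hp ω) (hf ω)

/-- Expectation is monotone in the observable. -/
lemma expect_mono {p : E → R} (hp : IsProbVec p) {f g : Config E → R} (hfg : ∀ ω, f ω ≤ g ω) :
    expect p f ≤ expect p g :=
  Finset.sum_le_sum fun ω _ => mul_le_mul_of_nonneg_left (hfg ω) (weight_nonneg hp ω)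

/-- Probabilities are nonnegative. -/
lemma prob_nonneg {p : E → R} (hp : IsProbVec p) (A : Set (Config E)) : 0 ≤ prob p A :=
  Finset.sum_nonneg fun ω _ => Set.indicator_apply_nonneg fun _ => weight_nonneg hp ω

/-- Probability is monotone in the event. -/
lemma prob_mono {p : E → R} (hp : IsProbVec p) {A B : Set (Config E)} (h : A ⊆ B) :
    prob p A ≤ prob p B :=
  Finset.sum_le_sum fun ω _ =>
    Set.indicator_le_indicator_apply_of_subset h (weight_nonneg hp ω)

/-- Probabilities are at most `1`. -/
lemma prob_le_one {p : E → R} (hp : IsProbVec p) (A : Set (Config E)) : prob p A ≤ 1 := by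
  rw [← prob_univ p]
  exact prob_mono hp (Set.subset_univ A)

/-- `P(A ∩ B) ≤ P(A)`. -/
lemma prob_inter_le_left {p : E → R} (hp : IsProbVec p) (A B : Set (Config E)) :
    prob p (A ∩ B) ≤ prob p A :=
  prob_mono hp Set.inter_subset_left

/-- `P(A ∩ B) ≤ P(B)`. -/
lemma prob_inter_le_right {p : E → R} (hp : IsProbVec p) (A B : Set (Config E)) :
    prob p (A ∩ B) ≤ prob p B :=
  prob_mono hp Set.inter_subset_right

/-- Union bound. -/
lemma prob_union_le {p : E → R} (hp : IsProbVec p) (A B : Set (Config E)) :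
    prob p (A ∪ B) ≤ prob p A + prob p B := by
  have h := prob_union_add_prob_inter p A B
  have h2 := prob_nonneg hp (A ∩ B)
  calc prob p (A ∪ B) ≤ prob p (A ∪ B) + prob p (A ∩ B) := le_add_of_nonneg_right h2
    _ = prob p A + prob p B := h

omit [Fintype E] in
/-- Forcing an edge open dominates forcing it closed in the configuration order. -/
lemma update_false_le_update_true (ω : Config E) (e : E) :
    Function.update ω e false ≤ Function.update ω e true := by
  intro e'
  by_cases h : e' = e
  · subst h; simp
  · simp [Function.update_of_ne h]

/-- For a monotone observable, pinning an edge open dominates pinning it closed. -/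
lemma expect_update_zero_le_expect_update_one {p : E → R} (hp : IsProbVec p)
    {f : Config E → R} (hf : Monotone f) (e : E) :
    expect (Function.update p e 0) f ≤ expect (Function.update p e 1) f := by
  rw [expect_update_zero, expect_update_one]
  exact expect_mono hp fun ω => hf (update_false_le_update_true ω e)

omit [Fintype E] [DecidableEq E] in
/-- The indicator of an increasing event is a monotone observable. -/
lemma monotone_indicator_of_isUpperSet {A : Set (Config E)} (hA : IsUpperSet A) :
    Monotone (A.indicator (1 : Config E → R)) := by
  intro ω ω' h
  by_cases hω : ω ∈ A
  · simp [hω, hA h hω]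
  · simp only [Set.indicator_of_notMem hω]
    exact Set.indicator_apply_nonneg fun _ => zero_le_one

end Order

/-! ## Point masses and the Harris–FKG inequality -/

section Harris

variable {E : Type*} [Fintype E] [DecidableEq E] {R : Type*} [CommRing R] [PartialOrder R]
  [IsStrictOrderedRing R]

/-- When every weight is `0` or `1`, the measure is a point mass: there is a configuration
`ω₀` with `E_p h = h ω₀` for every observable `h`. -/
lemma exists_expect_eq_of_pinned (p : E → R) (hpin : ∀ e, p e = 0 ∨ p e = 1) :
    ∃ ω₀ : Config E, ∀ h : Config E → R, expect p h = h ω₀ := by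
  classical
  refine ⟨fun e => decide (p e = 1), fun h => ?_⟩
  have hw : ∀ ω : Config E,
      weight p ω = if ω = (fun e => decide (p e = 1)) then 1 else 0 := by
    intro ω
    unfold weight
    have hfac : ∀ e, edgeFactor (p e) (ω e) =
        if ω e = decide (p e = 1) then (1 : R) else 0 := by
      intro e
      rcases hpin e with h0 | h1
      · rw [h0]; cases ω e <;> simp [edgeFactor]
      · rw [h1]; cases ω e <;> simp [edgeFactor]
    simp only [hfac]
    rw [Fintype.prod_boole]
    simp [funext_iff]
  unfold expect
  simp only [hw, ite_mul, one_mul, zero_mul]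
  simp

/-- **Harris–FKG inequality** for monotone observables, relative to a finite set `F` of
unpinned edges (all edges outside `F` have weight `0` or `1`); induction on `F`. -/
theorem expect_mul_expect_le_expect_mul_aux (F : Finset E) :
    ∀ p : E → R, IsProbVec p → (∀ e ∉ F, p e = 0 ∨ p e = 1) →
      ∀ f g : Config E → R, Monotone f → Monotone g →
        expect p f * expect p g ≤ expect p (f * g) := by
  induction F using Finset.induction_on with
  | empty =>
    intro p _ hpin f g _ _
    obtain ⟨ω₀, hω₀⟩ := exists_expect_eq_of_pinned p fun e => hpin e (Finset.notMem_empty e)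
    rw [hω₀, hω₀, hω₀]
    exact le_of_eq rfl
  | insert e F _ ih =>
    intro p hp hpin f g hf hg
    have hp1 : IsProbVec (Function.update p e 1) := hp.update e zero_le_one le_rfl
    have hp0 : IsProbVec (Function.update p e 0) := hp.update e le_rfl zero_le_one
    have hpin1 : ∀ e' ∉ F, Function.update p e 1 e' = 0 ∨ Function.update p e 1 e' = 1 := by
      intro e' he'
      by_cases h : e' = e
      · subst h; simp
      · rw [Function.update_of_ne h]
        exact hpin e' (by simp [he', h])
    have hpin0 : ∀ e' ∉ F, Function.update p e 0 e' = 0 ∨ Function.update p e 0 e' = 1 := by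
      intro e' he'
      by_cases h : e' = e
      · subst h; simp
      · rw [Function.update_of_ne h]
        exact hpin e' (by simp [he', h])
    have ih1 := ih _ hp1 hpin1 f g hf hg
    have ih0 := ih _ hp0 hpin0 f g hf hg
    have hF := expect_update_zero_le_expect_update_one hp hf e
    have hG := expect_update_zero_le_expect_update_one hp hg e
    have ha0 : 0 ≤ p e := hp.nonneg e
    have ha1 : 0 ≤ 1 - p e := sub_nonneg.2 (hp.le_one e)
    rw [expect_eq_pin p f e, expect_eq_pin p g e, expect_eq_pin p (f * g) e]
    calc (p e * expect (Function.update p e 1) f + (1 - p e) * expect (Function.update p e 0) f) *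
          (p e * expect (Function.update p e 1) g + (1 - p e) * expect (Function.update p e 0) g)
        = p e * (expect (Function.update p e 1) f * expect (Function.update p e 1) g)
            + (1 - p e) * (expect (Function.update p e 0) f * expect (Function.update p e 0) g)
            - p e * (1 - p e) *
              ((expect (Function.update p e 1) f - expect (Function.update p e 0) f) *
                (expect (Function.update p e 1) g - expect (Function.update p e 0) g)) := by
          ring
      _ ≤ p e * (expect (Function.update p e 1) f * expect (Function.update p e 1) g)
            + (1 - p e) * (expect (Function.update p e 0) f * expect (Function.update p e 0) g) :=
          (sub_le_self_iff _).2 (mul_nonneg (mul_nonneg ha0 ha1)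
            (mul_nonneg (sub_nonneg.2 hF) (sub_nonneg.2 hG)))
      _ ≤ p e * expect (Function.update p e 1) (f * g)
            + (1 - p e) * expect (Function.update p e 0) (f * g) :=
          add_le_add (mul_le_mul_of_nonneg_left ih1 ha0) (mul_le_mul_of_nonneg_left ih0 ha1)

/-- **Harris–FKG inequality** for monotone observables: `E_p f · E_p g ≤ E_p (f g)`. -/
theorem expect_mul_expect_le_expect_mul {p : E → R} (hp : IsProbVec p) {f g : Config E → R}
    (hf : Monotone f) (hg : Monotone g) : expect p f * expect p g ≤ expect p (f * g) :=
  expect_mul_expect_le_expect_mul_aux Finset.univ p hp (fun e he => (he (Finset.mem_univ e)).elim)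
    f g hf hg

/-- **Harris–FKG inequality** for increasing events: `P(A) P(B) ≤ P(A ∩ B)`. -/
theorem prob_mul_prob_le_prob_inter {p : E → R} (hp : IsProbVec p) {A B : Set (Config E)}
    (hA : IsUpperSet A) (hB : IsUpperSet B) : prob p A * prob p B ≤ prob p (A ∩ B) := by
  simp only [prob_eq_expect_indicator]
  have h := expect_mul_expect_le_expect_mul hp (monotone_indicator_of_isUpperSet (R := R) hA)
    (monotone_indicator_of_isUpperSet (R := R) hB)
  refine h.trans (le_of_eq ?_)
  unfold expect
  exact Finset.sum_congr rfl fun ω _ => by rw [Pi.mul_apply, ← indicator_inter_one]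

/-- Harris–FKG, mixed form: a decreasing and an increasing event are negatively correlated,
`P(A ∩ B) ≤ P(A) P(B)`. -/
theorem prob_inter_le_prob_mul_prob_of_isLowerSet {p : E → R} (hp : IsProbVec p)
    {A B : Set (Config E)} (hA : IsLowerSet A) (hB : IsUpperSet B) :
    prob p (A ∩ B) ≤ prob p A * prob p B := by
  have h := prob_mul_prob_le_prob_inter hp hA.compl hB
  have h2 := prob_inter_add_prob_inter_compl p B A
  rw [prob_compl] at h
  rw [Set.inter_comm B A, Set.inter_comm B Aᶜ] at h2
  calc prob p (A ∩ B) = prob p B - prob p (Aᶜ ∩ B) := by linear_combination h2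
    _ ≤ prob p B - (1 - prob p A) * prob p B := sub_le_sub_left h _
    _ = prob p A * prob p B := by ring

/-- Harris–FKG for decreasing events: `P(A) P(B) ≤ P(A ∩ B)`. -/
theorem prob_mul_prob_le_prob_inter_of_isLowerSet {p : E → R} (hp : IsProbVec p)
    {A B : Set (Config E)} (hA : IsLowerSet A) (hB : IsLowerSet B) :
    prob p A * prob p B ≤ prob p (A ∩ B) := by
  have h := prob_inter_le_prob_mul_prob_of_isLowerSet hp hA hB.compl
  have h2 := prob_inter_add_prob_inter_compl p A B
  rw [prob_compl] at h
  calc prob p A * prob p B = prob p A - prob p A * (1 - prob p B) := by ring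
    _ ≤ prob p A - prob p (A ∩ Bᶜ) := sub_le_sub_left h _
    _ = prob p (A ∩ B) := by linear_combination -h2

end Harris

end Summit.Ventures.PercRepro2
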